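import Literature.AlgebraicGeometry.Resolution.DenseRegularDescent
import Literature.AlgebraicGeometry.Resolution.CompletionBaseChange
import Summits.ResolutionOfSingularities.ResolutionOfSingularities.Theorems.FrobeniusLadderFRationalResolutionBlowupOrbitCentre
import Mathlib.RingTheory.Flat.FaithfullyFlat.Algebra
import Mathlib.RingTheory.Unramified.LocalRing
import HarnessLib

/-!
# Crux `FrobeniusLadder.FRationalResolution` (stmt-ResolutionOfSingularities-15317), line `redirect`,
# stub `stub_diagonalizableQuotientResolution` — COMPLETIONS AGREE ALONG A FLAT UNRAMIFIED LOCAL HOMOMORPHISM WITH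
# TRIVIAL RESIDUE EXTENSION (item (δ) of MEMO-15317-leafhand2-g16 §3: `Ê ≅ (F[P]_v)^` from the residue-trivial étale chart)

The Galois route of the stub ends (p838347 `…GaloisCharacteristicCentre`, p838626 `…BlowupRegularCompletionAscent`) in a
statement about the complete local ring `Ê = ((B ⊗_K K')_{𝔔'})^` of the upstairs point, which is to be identified with the
completion of the split toric germ through an étale chart with TRIVIAL residue field extension. The identification is the
classical fact: a local homomorphism `f : A → B` of local rings which is FLAT, UNRAMIFIED (`𝔪_A B = 𝔪_B`) and has trivial
residue field extension induces an isomorphism `Â ≅ B̂` of the adic completions. Surjectivity is the tree's density lemma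
(`Literature.….adicCompletionMap_surjective_of_dense`); injectivity is faithful flatness (`𝔪_Bⁿ ∩ A = 𝔪_Aⁿ B ∩ A = 𝔪_Aⁿ`,
Mathlib `Ideal.comap_map_eq_self_of_faithfullyFlat`) fed into the level criterion
`Literature.….adicCompletionMap_injective_of_quotientMap`. No dimension or analytic-irreducibility hypothesis is needed
(compare `Literature.….adicCompletionMap_bijective_of_dense`).

* `adicCompletionMap_injective_of_faithfullyFlat` — `B` faithfully flat over `A`, `𝔪_A B = 𝔪_B` ⇒ `Â → B̂` injective;
* `adicCompletionMap_bijective_of_flat` — `B` flat over `A` (local structure map), `𝔪_A B = 𝔪_B`, `A → B/𝔪_B` onto ⇒ bijective;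
* `adicCompletionMap_bijective_of_formallyUnramified` — the same with `𝔪_A B = 𝔪_B` supplied by Mathlib's
  `Algebra.FormallyUnramified.map_maximalIdeal` (essentially of finite type, formally unramified) and the residue condition
  read as surjectivity of `κ(A) → κ(B)`;
* `exists_ringEquiv_adicCompletion_of_flat` — the isomorphism `Â ≃+* B̂` over `f`, as an existence statement;
* `isRegular_affineBlowup_adicCompletion_transfer_of_flat` — consequence for the route: for an ideal `I ⊆ A`,
  `Bl_{I Â}(Spec Â)` regular ⇒ `Bl_{I B̂}(Spec B̂)` regular (transport along the isomorphism, tree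
  `…BlowupOrbitCentre.isRegular_affineBlowup_map_of_ringEquiv`).

Honest label: plumbing toward ONE leaf stub (no stub, crux or summit closed). No definitions, no named facts, no sorry.
[cite: Matsumura1987, Thm. 8.4; Thm. 8.14; Thm. 22.4] [cite: StacksProject, Tag 05GG; Tag 0C4G] [folklore]
-/

noncomputable section

-- single-problem summit: the doubled namespace component is forced
set_option linter.dupNamespace false

open IsLocalRing AdicCompletion AlgebraicGeometry
open Literature.AlgebraicGeometry.Resolution

namespace Summit.ResolutionOfSingularities.ResolutionOfSingularities.Theorems.FRationalResolution.CompletionOfFlatUnramified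

universe u

/-- **Injectivity of `Â → B̂` from faithful flatness.** If `B` is a faithfully flat `A`-algebra (`A`, `B` local) with
`𝔪_A B = 𝔪_B`, then every level map `A/𝔪_Aⁿ → B/𝔪_Bⁿ` is injective (`𝔪_Bⁿ = 𝔪_Aⁿ B` and `𝔪_Aⁿ B ∩ A = 𝔪_Aⁿ`), hence so is
the map of completions. [cite: Matsumura1987, Thm. 7.5 (ii); Thm. 8.4] -/
theorem adicCompletionMap_injective_of_faithfullyFlat {A B : Type u} [CommRing A] [CommRing B] [IsLocalRing A]
    [IsLocalRing B] [Algebra A B] [Module.FaithfullyFlat A B]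
    (hm : (maximalIdeal A).map (algebraMap A B) = maximalIdeal B) :
    Function.Injective (adicCompletionMap (maximalIdeal A) (maximalIdeal B) (algebraMap A B) hm.le) := by
  refine adicCompletionMap_injective_of_quotientMap (maximalIdeal A) (maximalIdeal B) (algebraMap A B) hm.le fun n => ?_
  refine Ideal.quotientMap_injective' ?_
  rw [← hm, ← Ideal.map_pow, Ideal.comap_map_eq_self_of_faithfullyFlat]

/-- **`Â ≅ B̂` for a flat unramified local homomorphism with trivial residue extension.** Let `B` be a flat local
`A`-algebra (`A`, `B` local, the structure map local) with `𝔪_A B = 𝔪_B` and `A → B/𝔪_B` onto. Then `Â → B̂` is bijective: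
onto by density (`adicCompletionMap_surjective_of_dense`), injective by faithful flatness (flat + local ⇒ faithfully flat).
[cite: Matsumura1987, Thm. 8.4; Thm. 22.4 (i)] [cite: StacksProject, Tag 0C4G] -/
theorem adicCompletionMap_bijective_of_flat {A B : Type u} [CommRing A] [CommRing B] [IsLocalRing A] [IsLocalRing B]
    [Algebra A B] [IsLocalHom (algebraMap A B)] [Module.Flat A B]
    (hm : (maximalIdeal A).map (algebraMap A B) = maximalIdeal B)
    (hres : ∀ b : B, ∃ a : A, b - algebraMap A B a ∈ maximalIdeal B) :
    Function.Bijective (adicCompletionMap (maximalIdeal A) (maximalIdeal B) (algebraMap A B) hm.le) := by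
  haveI : Module.FaithfullyFlat A B := Module.FaithfullyFlat.of_flat_of_isLocalHom
  exact ⟨adicCompletionMap_injective_of_faithfullyFlat hm, adicCompletionMap_surjective_of_dense (algebraMap A B) hm hres⟩

/-- Residue-field form of the density hypothesis: if `κ(A) → κ(B)` is onto then every `b ∈ B` is `≡ f(a) mod 𝔪_B` for some
`a ∈ A`. [folklore] -/
theorem forall_exists_sub_mem_of_residueField_surjective {A B : Type u} [CommRing A] [CommRing B] [IsLocalRing A]
    [IsLocalRing B] [Algebra A B] [IsLocalHom (algebraMap A B)]
    (hres : Function.Surjective (ResidueField.map (algebraMap A B))) :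
    ∀ b : B, ∃ a : A, b - algebraMap A B a ∈ maximalIdeal B := by
  intro b
  obtain ⟨x, hx⟩ := hres (residue B b)
  obtain ⟨a, rfl⟩ := residue_surjective x
  refine ⟨a, ?_⟩
  rw [ResidueField.map_residue] at hx
  rw [← Ideal.Quotient.eq]
  exact hx.symm

/-- **`Â ≅ B̂` for an essentially-of-finite-type, formally unramified, flat local algebra with trivial residue extension**
(e.g. the local ring map of an ÉTALE morphism at a point with trivial residue field extension): `𝔪_A B = 𝔪_B` is Mathlib's
`Algebra.FormallyUnramified.map_maximalIdeal`, and the residue condition is the surjectivity of `κ(A) → κ(B)`.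
[cite: StacksProject, Tag 00UW; Tag 0C4G] [cite: Matsumura1987, Thm. 8.4] -/
theorem adicCompletionMap_bijective_of_formallyUnramified {A B : Type u} [CommRing A] [CommRing B] [IsLocalRing A]
    [IsLocalRing B] [Algebra A B] [IsLocalHom (algebraMap A B)] [Algebra.EssFiniteType A B]
    [Algebra.FormallyUnramified A B] [Module.Flat A B]
    (hres : Function.Surjective (ResidueField.map (algebraMap A B))) :
    Function.Bijective (adicCompletionMap (maximalIdeal A) (maximalIdeal B) (algebraMap A B)
      (Algebra.FormallyUnramified.map_maximalIdeal (R := A) (S := B)).le) :=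
  adicCompletionMap_bijective_of_flat (Algebra.FormallyUnramified.map_maximalIdeal (R := A) (S := B))
    (forall_exists_sub_mem_of_residueField_surjective hres)

/-- **The isomorphism of completions, as an existence statement**: under the hypotheses of
`adicCompletionMap_bijective_of_flat` there is a ring isomorphism `e : Â ≃+* B̂` extending `f` (`e â = (f a)^`).
[cite: Matsumura1987, Thm. 8.4; Thm. 22.4 (i)] -/
theorem exists_ringEquiv_adicCompletion_of_flat {A B : Type u} [CommRing A] [CommRing B] [IsLocalRing A] [IsLocalRing B]
    [Algebra A B] [IsLocalHom (algebraMap A B)] [Module.Flat A B]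
    (hm : (maximalIdeal A).map (algebraMap A B) = maximalIdeal B)
    (hres : ∀ b : B, ∃ a : A, b - algebraMap A B a ∈ maximalIdeal B) :
    ∃ e : AdicCompletion (maximalIdeal A) A ≃+* AdicCompletion (maximalIdeal B) B,
      (e : AdicCompletion (maximalIdeal A) A →+* AdicCompletion (maximalIdeal B) B) =
          adicCompletionMap (maximalIdeal A) (maximalIdeal B) (algebraMap A B) hm.le ∧
        ∀ a : A, e (algebraMap A _ a) = algebraMap B _ (algebraMap A B a) := by
  refine ⟨RingEquiv.ofBijective _ (adicCompletionMap_bijective_of_flat hm hres), rfl, fun a => ?_⟩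
  rw [RingEquiv.ofBijective_apply, AdicCompletion.algebraMap_apply, AdicCompletion.algebraMap_apply]
  exact adicCompletionMap_of _ _ _ _ a

/-- **Transfer of blow-up regularity between the two completions.** Under the hypotheses of
`adicCompletionMap_bijective_of_flat`, for every ideal `I ⊆ A`: if `Bl_{I Â}(Spec Â)` is regular then `Bl_{I B̂}(Spec B̂)` is
regular (`I B̂ = e(I Â)` for the isomorphism `e : Â ≅ B̂`; transport `…BlowupOrbitCentre.isRegular_affineBlowup_map_of_ringEquiv`).
[cite: Matsumura1987, Thm. 8.4] [folklore] -/
theorem isRegular_affineBlowup_adicCompletion_transfer_of_flat {A B : Type} [CommRing A] [CommRing B] [IsLocalRing A]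
    [IsLocalRing B] [Algebra A B] [IsLocalHom (algebraMap A B)] [Module.Flat A B]
    (hm : (maximalIdeal A).map (algebraMap A B) = maximalIdeal B)
    (hres : ∀ b : B, ∃ a : A, b - algebraMap A B a ∈ maximalIdeal B) (I : Ideal A)
    (hreg : Scheme.IsRegular (affineBlowup (I.map (algebraMap A (AdicCompletion (maximalIdeal A) A))))) :
    Scheme.IsRegular (affineBlowup ((I.map (algebraMap A B)).map (algebraMap B (AdicCompletion (maximalIdeal B) B)))) := by
  obtain ⟨e, he, hea⟩ := exists_ringEquiv_adicCompletion_of_flat hm hres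
  have h := BlowupOrbitCentre.isRegular_affineBlowup_map_of_ringEquiv e _ hreg
  have hcomp : (I.map (algebraMap A (AdicCompletion (maximalIdeal A) A))).map (e : _ →+* _) =
      (I.map (algebraMap A B)).map (algebraMap B (AdicCompletion (maximalIdeal B) B)) := by
    rw [Ideal.map_map, Ideal.map_map]
    congr 1
    exact RingHom.ext fun a => by
      simp only [RingHom.coe_comp, RingHom.coe_coe, Function.comp_apply]
      exact hea a
  rw [hcomp] at h
  exact h

end Summit.ResolutionOfSingularities.ResolutionOfSingularities.Theorems.FRationalResolution.CompletionOfFlatUnramified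

end
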